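import Literature.Geometry.GaugeTheory.BPSTInstanton
import Literature.Geometry.GaugeTheory.AsdConnectionFlatModelGauge
import HarnessLib

/-!
# The BPST family in the charge-one moduli space of flat `ℝ⁴`: densities of the classes and
# injectivity of (centre, scale)

Topic `Literature/Geometry/GaugeTheory`; companion *proofs* file (theorems only: no definition, no
named fact) of `BPSTInstanton.lean`. With the gauge invariance of the curvature density over flat
`ℝ⁴` (`AsdConnectionFlatModelGauge.lean`, `AsdModuliSpace.density_mk`) the BPST instantons
`BPST.instanton a λ` descend to the moduli space `M₁(ℝ⁴) = AsdModuliSpace (euclideanMetric ℝ⁴)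
(SmoothOrientation.euclidean 4) 1` of the tree's model with

* `BPST.density_mk_instanton` — the density of the CLASS `[A_{a,λ}]` is the BPST density
  `ρ_{a,λ}(x) = 48 λ⁴/(λ² + ‖x - a‖²)⁴` (`bpstDensity a λ`, whose Fisher–Rao form along the family
  is computed in `BPSTInformationMetric.lean`);
* `BPST.bpstDensity_lt_of_ne`, `BPST.bpstDensity_eq_iff_eq_centre` — `ρ_{a,λ}` has a strict
  maximum `48/λ⁴` exactly at the centre (Naber 1997, §5.3 after Exercise 5.3.1: "a maximum value
  … at `q = n`"), so that `BPST.eq_of_bpstDensity_eq`: the density determines `(a, λ)`, `λ > 0`;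
* `BPST.mk_instanton_injective`, `BPST.injective_mk_instanton` — hence the five-parameter family
  `(a, λ) ↦ [A_{a,λ}]`, `λ > 0`, is INJECTIVE into `M₁(ℝ⁴)`: distinct centres or scales give gauge
  inequivalent instantons (the flat-space shadow of the injectivity of the scale-and-centre collar
  map of Groisser–Murray 1997, §3, p. 6 / Donaldson 1983).

## References

* G. L. Naber, *Topology, Geometry, and Gauge Fields* (1997), §5.3, Exercise 5.3.1 and the
  paragraph following it (centre and scale of `A_{λ,n}`; the maximum of `‖F_{λ,n}(q)‖²` at
  `q = n`). [Naber1997]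
* D. Groisser, M. K. Murray, *Instantons and the information metric* (1997), §3, p. 6.
  [GroisserMurray1997]
-/

noncomputable section

open scoped Manifold ContDiff Topology Quaternion
open Set Function
open Literature.Geometry.Riemannian (euclideanMetric)
open Literature.Topology.FourManifolds

namespace Literature.Geometry.GaugeTheory

namespace BPST

/-! ### The density has a strict maximum at the centre -/

/-- **Strict maximum of the BPST density at the centre**: `ρ_{a,λ}(x) < 48/λ⁴ = ρ_{a,λ}(a)` for
`x ≠ a` (Naber 1997, §5.3, after Exercise 5.3.1: the field strength has its maximum at the centre
`q = n`; in the tree's normalisation the maximum is `48/λ⁴`). [cite: Naber1997, §5.3 Exercise 5.3.1] -/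
theorem bpstDensity_lt_of_ne (a : EuclideanSpace ℝ (Fin 4)) {l : ℝ} (hl : l ≠ 0)
    {x : EuclideanSpace ℝ (Fin 4)} (hx : x ≠ a) : bpstDensity a l x < 48 / l ^ 4 := by
  rw [bpstDensity_apply]
  have hl2 : 0 < l ^ 2 := by positivity
  have hl4 : 0 < l ^ 4 := by positivity
  have hd : 0 < ‖x - a‖ ^ 2 := by
    have : 0 < ‖x - a‖ := norm_pos_iff.2 (sub_ne_zero.2 hx)
    positivity
  rw [div_lt_div_iff₀ (by positivity) hl4]
  have h : (l ^ 2) ^ 4 < (l ^ 2 + ‖x - a‖ ^ 2) ^ 4 :=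
    pow_lt_pow_left₀ (by linarith) hl2.le (by norm_num)
  nlinarith [h]

/-- The BPST density attains the value `48/λ⁴` exactly at the centre. [cite: Naber1997, §5.3 Exercise 5.3.1] -/
theorem bpstDensity_eq_iff_eq_centre (a : EuclideanSpace ℝ (Fin 4)) {l : ℝ} (hl : l ≠ 0)
    (x : EuclideanSpace ℝ (Fin 4)) : bpstDensity a l x = 48 / l ^ 4 ↔ x = a := by
  refine ⟨fun h ↦ ?_, fun h ↦ by rw [h, bpstDensity_self a hl]⟩
  by_contra hx
  exact (bpstDensity_lt_of_ne a hl hx).ne h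

/-- **The density determines centre and (positive) scale**: if `ρ_{a,λ} = ρ_{a',λ'}` as functions
on `ℝ⁴` with `λ, λ' > 0` then `a = a'` and `λ = λ'` (compare the maxima `48/λ⁴ = 48/λ'⁴` and their
locations). [cite: Naber1997, §5.3 Exercise 5.3.1] -/
theorem eq_of_bpstDensity_eq {a a' : EuclideanSpace ℝ (Fin 4)} {l l' : ℝ} (hl : 0 < l)
    (hl' : 0 < l') (h : bpstDensity a l = bpstDensity a' l') : a = a' ∧ l = l' := by
  have h1 : 48 / l ^ 4 ≤ 48 / l' ^ 4 := by
    rw [← bpstDensity_self a hl.ne', h]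
    exact bpstDensity_le a' hl'.ne' a
  have h2 : 48 / l' ^ 4 ≤ 48 / l ^ 4 := by
    rw [← bpstDensity_self a' hl'.ne', ← h]
    exact bpstDensity_le a hl.ne' a'
  have h3 : 48 / l ^ 4 = 48 / l' ^ 4 := le_antisymm h1 h2
  have hl4 : l ^ 4 = l' ^ 4 := by
    have hp : (0 : ℝ) < l ^ 4 := by positivity
    have hp' : (0 : ℝ) < l' ^ 4 := by positivity
    field_simp at h3
    linarith
  have hll : l = l' := (pow_left_inj₀ hl.le hl'.le (by norm_num)).1 hl4
  subst hll
  refine ⟨?_, rfl⟩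
  have h4 : bpstDensity a' l a = 48 / l ^ 4 := by rw [← h, bpstDensity_self a hl.ne']
  exact (bpstDensity_eq_iff_eq_centre a' hl.ne' a).1 h4

/-! ### The BPST classes in `M₁(ℝ⁴)` -/

/-- **The density of the class of a BPST instanton is the BPST density**: in `M₁(ℝ⁴)` (the
tree's `AsdModuliSpace` of flat `ℝ⁴`, Euclidean metric, standard orientation),
`ρ_{[A_{a,λ}]} = bpstDensity a λ = 48 λ⁴/(λ² + ‖· - a‖²)⁴` — the curvature density is gauge
invariant (`AsdModuliSpace.density_mk`) and equals `bpstDensity` on the representative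
(`BPST.curvatureDensity_connection`; Naber 1997, Exercise 5.3.1). [cite: Naber1997, §5.3 Exercise 5.3.1] -/
theorem density_mk_instanton (a : EuclideanSpace ℝ (Fin 4)) {l : ℝ} (hl : l ≠ 0) :
    (AsdModuliSpace.mk (instanton a (basePoint (EuclideanSpace ℝ (Fin 4))) hl)).density
        (euclideanMetric (EuclideanSpace ℝ (Fin 4))) = bpstDensity a l := by
  rw [AsdModuliSpace.density_mk]
  funext x
  exact curvatureDensity_connection a (basePoint (EuclideanSpace ℝ (Fin 4))) hl x

/-- Pointwise form of `density_mk_instanton`. [cite: Naber1997, §5.3 Exercise 5.3.1] -/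
theorem density_mk_instanton_apply (a : EuclideanSpace ℝ (Fin 4)) {l : ℝ} (hl : l ≠ 0)
    (x : EuclideanSpace ℝ (Fin 4)) :
    (AsdModuliSpace.mk (instanton a (basePoint (EuclideanSpace ℝ (Fin 4))) hl)).density
        (euclideanMetric (EuclideanSpace ℝ (Fin 4))) x = 48 * l ^ 4 / (l ^ 2 + ‖x - a‖ ^ 2) ^ 4 := by
  rw [density_mk_instanton, bpstDensity_apply]

/-- **Distinct centres or scales give gauge inequivalent BPST instantons**: if
`[A_{a,λ}] = [A_{a',λ'}]` in `M₁(ℝ⁴)` with `λ, λ' > 0` then `a = a'` and `λ = λ'` (their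
classes have different densities otherwise). [cite: Naber1997, §5.3 Exercise 5.3.1] -/
theorem mk_instanton_injective {a a' : EuclideanSpace ℝ (Fin 4)} {l l' : ℝ} (hl : 0 < l)
    (hl' : 0 < l')
    (h : AsdModuliSpace.mk (instanton a (basePoint (EuclideanSpace ℝ (Fin 4))) hl.ne') =
      AsdModuliSpace.mk (instanton a' (basePoint (EuclideanSpace ℝ (Fin 4))) hl'.ne')) :
    a = a' ∧ l = l' := by
  have hd := congrArg
    (fun c ↦ AsdModuliSpace.density (euclideanMetric (EuclideanSpace ℝ (Fin 4))) c) h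
  simp only [density_mk_instanton] at hd
  exact eq_of_bpstDensity_eq hl hl' hd

/-- **The BPST family injects into `M₁(ℝ⁴)`**: the map `(a, λ) ↦ [A_{a,λ}]` from
`ℝ⁴ × (0, ∞)` to the charge-one moduli space of flat `ℝ⁴` (tree's model) is injective — the
flat-space shadow of the scale-and-centre parametrisation of concentrated instantons
(Groisser–Murray 1997, §3, p. 6). [cite: GroisserMurray1997, §3 p. 6] -/
theorem injective_mk_instanton :
    Function.Injective (fun q : EuclideanSpace ℝ (Fin 4) × {l : ℝ // 0 < l} ↦
      AsdModuliSpace.mk (instanton q.1 (basePoint (EuclideanSpace ℝ (Fin 4))) q.2.2.ne')) := by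
  rintro ⟨a, l, hl⟩ ⟨a', l', hl'⟩ h
  obtain ⟨ha, hll⟩ := mk_instanton_injective hl hl' h
  subst ha
  subst hll
  rfl

end BPST

end Literature.Geometry.GaugeTheory

end
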